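import Summits.RiemannHypothesis.RiemannHypothesis.Theorems.TiltedLandingLaw421R3IsoTilt2
import Literature.Analysis.Complex.RoucheTheorem
import Literature.Topology.PlaneTopology.ArgumentIncrement
import Summits.RiemannHypothesis.RiemannHypothesis.Theorems.TiltedLandingLaw421R3NestedSign
import Summits.RiemannHypothesis.RiemannHypothesis.Theorems.TiltedLandingLaw421R3Lens1PinningIsoB

/-! # RATE CHILD COUNT (A) — quadrant winding lemma + the CHILD COUNT on the Jensen circle (lens-2 g4, stmt-RiemannHypothesis-33346,
RATE residual; module 1/3 of the (CA557) cut of `Cruxes/TiltedLandingLaw421R/Lens2_ChildExists.lean`; ns `RhW08.ChildCount`; by import of tree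
`…R3IsoTilt2` (`RhW08.IsolatedTilt.pairQ`) + `Literature` Rouché / argument increment; 0 `sorry`, no instances/notation.)
§1 ★ `wind_eq_of_quadrants`: a loop through `P → r₁ → Q → r₂ → P` (`P, Q` real `≠ 0`, `r₁, r₂ > 0`) confined quarter by quarter to the closed
half-planes `Im ≤ 0 / ≥ 0 / ≤ 0 / ≥ 0` winds `[P < 0] + [Q < 0]` times.  §2 `pairQ_circle`, ★★ `childCount`: for `G = q·h` (`q = pairQ a b`), `h`
zero-free on the closed Jensen disc with the JENSEN SIGN `Im z·Im(h′/h) ≤ 0` on the circle and no critical point of `G` on it, `G′` has EXACTLY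
`1 + [1 + b·(h′/h)(a+b) < 0] + [1 − b·(h′/h)(a−b) < 0]` zeros in the open disc (Rouché divisor count of `G′ = h·2(z − a)·(1 + b cos θ·h′/h)`).
Nothing here bears on the truth of RH; RH is not proved; 33346/33347 OPEN; checked ≠ proved. -/

noncomputable section

open Complex Metric Set
open scoped Real ComplexConjugate
open Literature.Topology.PlaneTopology
open Literature.Analysis.Complex

namespace RhW08.ChildCount

/-! ## §1 a QUADRANT WINDING LEMMA: a loop through `P → r₁ → Q → r₂ → P` (reals, `r₁, r₂ > 0`) alternating between the closed lower and
upper half-planes winds `[P < 0] + [Q < 0]` times about `0` -/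

/-- (K) `log (−I·x) − log (I·x) = ±πI` according to the sign of the non-zero real `x`. -/
theorem log_negI_mul_sub_log_I_mul {x : ℝ} (hx : x ≠ 0) :
    log (-I * x) - log (I * x) = if x < 0 then (π : ℂ) * I else -((π : ℂ) * I) := by
  rcases lt_or_gt_of_ne hx with h | h
  · have e1 : -I * (x : ℂ) = ((-x : ℝ) : ℂ) * I := by push_cast; ring
    have e2 : I * (x : ℂ) = ((-x : ℝ) : ℂ) * (-I) := by push_cast; ring
    rw [e1, e2, log_ofReal_mul (by linarith) I_ne_zero, log_ofReal_mul (by linarith) (neg_ne_zero.2 I_ne_zero),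
      log_I, log_neg_I, if_pos h]
    ring
  · have e1 : -I * (x : ℂ) = ((x : ℝ) : ℂ) * (-I) := by ring
    have e2 : I * (x : ℂ) = ((x : ℝ) : ℂ) * I := by ring
    rw [e1, e2, log_ofReal_mul h (neg_ne_zero.2 I_ne_zero), log_ofReal_mul h I_ne_zero, log_I, log_neg_I,
      if_neg (not_lt.2 h.le)]
    ring

/-- (K) `I·w` avoids the cut `(−∞, 0]` when `w ≠ 0` lies in the closed lower half-plane. -/
theorem I_mul_mem_slitPlane {w : ℂ} (hw : w ≠ 0) (him : w.im ≤ 0) : I * w ∈ slitPlane := by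
  rw [mem_slitPlane_iff]
  have hre : (I * w).re = -w.im := by simp
  have hi : (I * w).im = w.re := by simp
  rw [hre, hi]
  rcases lt_or_eq_of_le him with h | h
  · left; linarith
  · right
    intro hre0
    exact hw (Complex.ext (by simpa using hre0) (by simpa using h))

/-- (K) `−I·w` avoids the cut `(−∞, 0]` when `w ≠ 0` lies in the closed upper half-plane. -/
theorem negI_mul_mem_slitPlane {w : ℂ} (hw : w ≠ 0) (him : 0 ≤ w.im) : -I * w ∈ slitPlane := by
  rw [mem_slitPlane_iff]
  have hre : (-I * w).re = w.im := by simp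
  have hi : (-I * w).im = -w.re := by simp
  rw [hre, hi]
  rcases lt_or_eq_of_le him with h | h
  · left; linarith
  · right
    intro hre0
    exact hw (Complex.ext (by simpa using hre0) (by simpa using h.symm))

/-- (K) increment of the logarithm of a piece staying in the closed LOWER half-plane minus `0`. -/
theorem logInc_eq_of_im_nonpos {Φ : ℝ → ℂ} (hc : ContinuousOn Φ (Icc 0 1)) (h0 : ∀ t ∈ Icc (0:ℝ) 1, Φ t ≠ 0)
    (him : ∀ t ∈ Icc (0:ℝ) 1, (Φ t).im ≤ 0) : logInc Φ = log (I * Φ 1) - log (I * Φ 0) := by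
  have hmem : ∀ t ∈ Icc (0:ℝ) 1, I * Φ t ∈ slitPlane := fun t ht => I_mul_mem_slitPlane (h0 t ht) (him t ht)
  have hl : ContinuousOn (fun t => log (I * Φ t) + log (-I)) (Icc 0 1) :=
    ((continuousOn_const.mul hc).clog hmem).add continuousOn_const
  rw [logInc_eq hl fun t ht => ?_]
  · ring
  · rw [exp_add, exp_log (slitPlane_ne_zero (hmem t ht)), exp_log (neg_ne_zero.2 I_ne_zero),
      show I * Φ t * -I = -(I * I) * Φ t by ring, I_mul_I]
    ring

/-- (K) increment of the logarithm of a piece staying in the closed UPPER half-plane minus `0`. -/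
theorem logInc_eq_of_im_nonneg {Φ : ℝ → ℂ} (hc : ContinuousOn Φ (Icc 0 1)) (h0 : ∀ t ∈ Icc (0:ℝ) 1, Φ t ≠ 0)
    (him : ∀ t ∈ Icc (0:ℝ) 1, 0 ≤ (Φ t).im) : logInc Φ = log (-I * Φ 1) - log (-I * Φ 0) := by
  have hmem : ∀ t ∈ Icc (0:ℝ) 1, -I * Φ t ∈ slitPlane := fun t ht => negI_mul_mem_slitPlane (h0 t ht) (him t ht)
  have hl : ContinuousOn (fun t => log (-I * Φ t) + log I) (Icc 0 1) :=
    ((continuousOn_const.mul hc).clog hmem).add continuousOn_const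
  rw [logInc_eq hl fun t ht => ?_]
  · ring
  · rw [exp_add, exp_log (slitPlane_ne_zero (hmem t ht)), exp_log I_ne_zero,
      show -I * Φ t * I = -(I * I) * Φ t by ring, I_mul_I]
    ring

/-- (K) ★ **QUADRANT WINDING LEMMA.** A loop `φ` on `[0,1]` in `ℂ \ {0}` with `φ 0 = P`, `φ (1/4) = r₁ > 0`, `φ (1/2) = Q`, `φ (3/4) = r₂ > 0`
all real, staying in the closed lower half-plane on `[0,1/4] ∪ [1/2,3/4]` and in the closed upper half-plane on `[1/4,1/2] ∪ [3/4,1]`, winds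
`[P < 0] + [Q < 0]` times about `0`. -/
theorem wind_eq_of_quadrants {φ : ℝ → ℂ} (hc : ContinuousOn φ (Icc 0 1)) (h01 : φ 0 = φ 1)
    (h0 : ∀ t ∈ Icc (0:ℝ) 1, φ t ≠ 0)
    (hq1 : ∀ t ∈ Icc (0:ℝ) (1/4), (φ t).im ≤ 0) (hq2 : ∀ t ∈ Icc (1/4:ℝ) (1/2), 0 ≤ (φ t).im)
    (hq3 : ∀ t ∈ Icc (1/2:ℝ) (3/4), (φ t).im ≤ 0) (hq4 : ∀ t ∈ Icc (3/4:ℝ) 1, 0 ≤ (φ t).im)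
    (hr0 : (φ 0).im = 0) (hr2 : (φ (1/2)).im = 0)
    (hr1 : (φ (1/4)).im = 0) (hp1 : 0 < (φ (1/4)).re) (hr3 : (φ (3/4)).im = 0) (hp3 : 0 < (φ (3/4)).re) :
    wind φ = (if (φ 0).re < 0 then 1 else 0) + (if (φ (1/2)).re < 0 then 1 else 0) := by
  have hloop : IsNonvanishingLoop φ := ⟨hc, h0, h01⟩
  -- affine pieces
  have piece : ∀ (k : ℝ) (n : ℝ), 0 ≤ k → 0 < n → k + 1 ≤ n →
      ContinuousOn (fun t : ℝ => φ ((t + k) / n)) (Icc 0 1) ∧ (∀ t ∈ Icc (0:ℝ) 1, φ ((t + k) / n) ≠ 0) ∧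
      ∀ t ∈ Icc (0:ℝ) 1, (t + k) / n ∈ Icc (k / n) ((k + 1) / n) := by
    intro k n hk hn hkn
    have hmaps : ∀ t ∈ Icc (0:ℝ) 1, (t + k) / n ∈ Icc (k / n) ((k + 1) / n) := fun t ht =>
      ⟨div_le_div_of_nonneg_right (by linarith [ht.1]) hn.le, div_le_div_of_nonneg_right (by linarith [ht.2]) hn.le⟩
    have hsub : ∀ t ∈ Icc (0:ℝ) 1, (t + k) / n ∈ Icc (0:ℝ) 1 := fun t ht => by
      have h := hmaps t ht
      refine ⟨le_trans (div_nonneg hk hn.le) h.1, le_trans h.2 ?_⟩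
      rw [div_le_one hn]; exact hkn
    have hcont : Continuous fun t : ℝ => (t + k) / n := by fun_prop
    exact ⟨hc.comp hcont.continuousOn hsub, fun t ht => h0 _ (hsub t ht), hmaps⟩
  obtain ⟨c0, n0, m0⟩ := piece 0 4 le_rfl (by norm_num) (by norm_num)
  obtain ⟨c1, n1, m1⟩ := piece 1 4 (by norm_num) (by norm_num) (by norm_num)
  obtain ⟨c2, n2, m2⟩ := piece 2 4 (by norm_num) (by norm_num) (by norm_num)
  obtain ⟨c3, n3, m3⟩ := piece 3 4 (by norm_num) (by norm_num) (by norm_num)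
  obtain ⟨ch0, nh0, -⟩ := piece 0 2 le_rfl (by norm_num) (by norm_num)
  obtain ⟨ch1, nh1, -⟩ := piece 1 2 (by norm_num) (by norm_num) (by norm_num)
  -- the two halvings
  have e := logInc_eq_wind_mul hloop
  rw [logInc_eq_add_halves hloop.hasLogOn] at e
  have hh0 : HasLogOn (fun t : ℝ => φ (t / 2)) (Icc 0 1) := by
    have := hasLogOn_Icc ch0 nh0; simpa using this
  have hh1 : HasLogOn (fun t : ℝ => φ ((t + 1) / 2)) (Icc 0 1) := hasLogOn_Icc ch1 nh1
  rw [logInc_eq_add_halves hh0, logInc_eq_add_halves hh1] at e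
  have r0 : logInc (fun t : ℝ => φ (t / 2 / 2)) = logInc (fun t : ℝ => φ ((t + 0) / 4)) :=
    logInc_congr fun t _ => by congr 1; ring
  have r1 : logInc (fun t : ℝ => φ ((t + 1) / 2 / 2)) = logInc (fun t : ℝ => φ ((t + 1) / 4)) :=
    logInc_congr fun t _ => by congr 1; ring
  have r2 : logInc (fun t : ℝ => φ ((t / 2 + 1) / 2)) = logInc (fun t : ℝ => φ ((t + 2) / 4)) :=
    logInc_congr fun t _ => by congr 1; ring
  have r3 : logInc (fun t : ℝ => φ (((t + 1) / 2 + 1) / 2)) = logInc (fun t : ℝ => φ ((t + 3) / 4)) :=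
    logInc_congr fun t _ => by congr 1; ring
  rw [r0, r1, r2, r3] at e
  -- the four quarter increments
  have q0 := logInc_eq_of_im_nonpos c0 n0 fun t ht => hq1 _ (by have h := m0 t ht; norm_num at h ⊢; exact h)
  have q1 := logInc_eq_of_im_nonneg c1 n1 fun t ht => hq2 _ (by have h := m1 t ht; norm_num at h ⊢; exact h)
  have q2 := logInc_eq_of_im_nonpos c2 n2 fun t ht => hq3 _ (by have h := m2 t ht; norm_num at h ⊢; exact h)
  have q3 := logInc_eq_of_im_nonneg c3 n3 fun t ht => hq4 _ (by have h := m3 t ht; norm_num at h ⊢; exact h)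
  rw [q0, q1, q2, q3] at e
  norm_num at e
  rw [← h01] at e
  -- real values
  have vP : φ 0 = ((φ 0).re : ℂ) := Complex.ext (by rw [ofReal_re]) (by rw [ofReal_im]; exact hr0)
  have vQ : φ (1/2) = ((φ (1/2)).re : ℂ) := Complex.ext (by rw [ofReal_re]) (by rw [ofReal_im]; exact hr2)
  have v1 : φ (1/4) = ((φ (1/4)).re : ℂ) := Complex.ext (by rw [ofReal_re]) (by rw [ofReal_im]; exact hr1)
  have v3 : φ (3/4) = ((φ (3/4)).re : ℂ) := Complex.ext (by rw [ofReal_re]) (by rw [ofReal_im]; exact hr3)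
  have hP0 : (φ 0).re ≠ 0 := fun h => h0 0 ⟨le_rfl, zero_le_one⟩ (by rw [vP, h]; simp)
  have hQ0 : (φ (1/2)).re ≠ 0 := fun h => h0 (1/2) ⟨by norm_num, by norm_num⟩ (by rw [vQ, h]; simp)
  have sP := log_negI_mul_sub_log_I_mul hP0
  have sQ := log_negI_mul_sub_log_I_mul hQ0
  have s1 := log_negI_mul_sub_log_I_mul hp1.ne'
  have s3 := log_negI_mul_sub_log_I_mul hp3.ne'
  rw [if_neg (not_lt.2 hp1.le)] at s1
  rw [if_neg (not_lt.2 hp3.le)] at s3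
  rw [← vP] at sP; rw [← vQ] at sQ; rw [← v1] at s1; rw [← v3] at s3
  simp only [neg_mul] at sP sQ s1 s3
  have key : (wind φ : ℂ) * (2 * π * I) =
      (if (φ 0).re < 0 then (π : ℂ) * I else -((π : ℂ) * I)) + (if (φ (1/2)).re < 0 then (π : ℂ) * I else -((π : ℂ) * I))
        + 2 * π * I := by
    rw [← e, ← sP, ← sQ]; linear_combination -s1 - s3
  apply int_eq_of_mul_two_pi_I_eq
  rw [key]
  split_ifs <;> push_cast <;> ring

/-! ## §2 the CHILD COUNT on the Jensen circle of a removed pair (`G = q·h`, `q = pairQ a b`; on the circle `q = 2b cos θ·(z − a)`, so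
`G′ = h·2(z − a)·g`, `g = 1 + b cos θ·(h′/h)` runs `P → 1 → Q → 1 → P` through alternating closed half-planes by the Jensen sign; §1 counts) -/

open RhW08.IsolatedTilt (pairQ)

/-- (K) the pair factor on its own Jensen circle: `q(a + b e^{iθ}) = 2·(b cos θ)·(b e^{iθ})`. -/
theorem pairQ_circle (a b θ : ℝ) :
    pairQ a b ((a : ℂ) + b * exp (θ * I)) = 2 * ((b * Real.cos θ : ℝ) : ℂ) * (b * exp (θ * I)) := by
  simp only [pairQ, add_sub_cancel_left, exp_mul_I]
  push_cast
  have h := Complex.cos_sq_add_sin_sq (θ : ℂ)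
  linear_combination (-(b : ℂ) ^ 2) * h + (b : ℂ) ^ 2 * Complex.sin θ ^ 2 * I_sq

set_option maxHeartbeats 1600000 in
/-- ★★ (K) **CHILD COUNT ON THE JENSEN CIRCLE.** `G = q·h` on `‖z − a‖ < ρ` (`q = pairQ a b`, `0 < b < ρ`), `h` zero-free on `‖z − a‖ ≤ b`,
Jensen sign `Im z · Im (h′/h)(z) ≤ 0` and `h′/h` real at real points of the circle `‖z − a‖ = b`, and `G′` zero-free on that circle.  Then the
number of zeros of `G′` in the open Jensen disc, counted with multiplicity, is
`1 + [1 + b·Re (h′/h)(a + b) < 0] + [1 − b·Re (h′/h)(a − b) < 0]`. -/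
theorem childCount {G h : ℂ → ℂ} {a b ρ : ℝ} (hb : 0 < b) (hbρ : b < ρ)
    (hGd : DifferentiableOn ℂ G (ball (a : ℂ) ρ)) (hh : DifferentiableOn ℂ h (ball (a : ℂ) ρ))
    (hfac : ∀ z ∈ ball (a : ℂ) ρ, G z = pairQ a b z * h z) (hh0 : ∀ z ∈ closedBall (a : ℂ) b, h z ≠ 0)
    (hsign : ∀ z : ℂ, ‖z - a‖ = b → z.im * (deriv h z / h z).im ≤ 0)
    (hKreal : ∀ x : ℝ, ‖(x : ℂ) - a‖ = b → (deriv h x / h x).im = 0)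
    (hcirc : ∀ z : ℂ, ‖z - a‖ = b → deriv G z ≠ 0) :
    ∑ᶠ u, MeromorphicOn.divisor (deriv G) (closedBall (a : ℂ) b) u =
      1 + (if 1 + b * (deriv h ((a : ℂ) + b) / h ((a : ℂ) + b)).re < 0 then 1 else 0)
        + (if 1 - b * (deriv h ((a : ℂ) - b) / h ((a : ℂ) - b)).re < 0 then 1 else 0) := by
  set γ : ℝ → ℂ := circleLoop (a : ℂ) b with hγ
  set K : ℂ → ℂ := fun z => deriv h z / h z with hK
  set F : ℂ → ℂ := fun z => 2 * (z - a) + pairQ a b z * K z with hF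
  set g : ℝ → ℂ := fun t => 1 + ((b * Real.cos (2 * π * t) : ℝ) : ℂ) * K (γ t) with hg
  -- geometry of the Jensen circle
  have hγa : ∀ t : ℝ, γ t - a = b * exp (((2 * π * t : ℝ)) * I) := by
    intro t; rw [hγ, circleLoop_apply]; push_cast; ring
  have hγe : ∀ t : ℝ, γ t = (a : ℂ) + b * exp (((2 * π * t : ℝ)) * I) := fun t => by rw [← hγa t]; ring
  have hγnorm : ∀ t : ℝ, ‖γ t - a‖ = b := by intro t; rw [hγ, norm_circleLoop_sub_center, abs_of_pos hb]
  have hγball : ∀ t : ℝ, γ t ∈ ball (a : ℂ) ρ := fun t => by rw [mem_ball, dist_eq_norm, hγnorm]; exact hbρ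
  have hγcl : ∀ t : ℝ, γ t ∈ closedBall (a : ℂ) b := fun t => by rw [mem_closedBall, dist_eq_norm, hγnorm]
  have hγim : ∀ t : ℝ, (γ t).im = b * Real.sin (2 * π * t) := by
    intro t
    have := congrArg Complex.im (hγa t)
    rw [sub_im, ofReal_im, sub_zero, im_ofReal_mul, exp_ofReal_mul_I_im] at this
    exact this
  have h01γ : γ 0 = γ 1 := by rw [hγ]; exact circleLoop_zero_eq _ _
  have hγ0 : γ 0 = (((a + b : ℝ)) : ℂ) := by rw [hγe]; push_cast; simp
  have hγhalf : γ (1 / 2) = (((a - b : ℝ)) : ℂ) := by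
    rw [hγe, show (((2 * π * (1 / 2 : ℝ) : ℝ)) : ℂ) * I = π * I by push_cast; ring, exp_pi_mul_I]; push_cast; ring
  -- calculus: `G′ = 2(z − a)h + q h′` on the disc, `= h·F` on the circle, `F = 2(z − a)·g` on the circle
  have hderiv : ∀ z ∈ ball (a : ℂ) ρ, deriv G z = 2 * (z - a) * h z + pairQ a b z * deriv h z := by
    intro z hz
    have hev : G =ᶠ[nhds z] fun w => pairQ a b w * h w :=
      Filter.eventuallyEq_of_mem (isOpen_ball.mem_nhds hz) fun w hw => hfac w hw
    rw [hev.deriv_eq]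
    have hq : HasDerivAt (pairQ a b) (2 * (z - a)) z := RhW07.Law421.SuccessorCertificate.hasDerivAt_quadP a b z
    exact (hq.mul ((hh z hz).differentiableAt (isOpen_ball.mem_nhds hz)).hasDerivAt).deriv
  have hGF : ∀ t : ℝ, deriv G (γ t) = h (γ t) * F (γ t) := by
    intro t
    have hz := hh0 _ (hγcl t)
    rw [hderiv _ (hγball t), hF, hK]
    field_simp
  have hFg : ∀ t : ℝ, F (γ t) = 2 * (γ t - a) * g t := by
    intro t
    have hq : pairQ a b (γ t) = 2 * ((b * Real.cos (2 * π * t) : ℝ) : ℂ) * (b * exp ((2 * π * t : ℝ) * I)) := by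
      rw [hγe t]; exact pairQ_circle a b (2 * π * t)
    simp only [hF, hg]
    rw [hq, hγa t]
    ring
  -- regularity
  have hG'd : DifferentiableOn ℂ (deriv G) (ball (a : ℂ) ρ) := (hGd.analyticOnNhd isOpen_ball).deriv.differentiableOn
  have hh'd : DifferentiableOn ℂ (deriv h) (ball (a : ℂ) ρ) := (hh.analyticOnNhd isOpen_ball).deriv.differentiableOn
  have hKc : ContinuousOn K (closedBall (a : ℂ) b) :=
    (hh'd.continuousOn.mono (closedBall_subset_ball hbρ)).div (hh.continuousOn.mono (closedBall_subset_ball hbρ)) hh0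
  have hqc : Continuous (pairQ a b) := by unfold pairQ; fun_prop
  have hFc : ContinuousOn F (closedBall (a : ℂ) b) :=
    ((continuous_const.mul (continuous_id.sub continuous_const)).continuousOn).add (hqc.continuousOn.mul hKc)
  have hγc : Continuous γ := by rw [hγ]; exact continuous_circleLoop _ _
  have hcosc : Continuous fun t : ℝ => (((b * Real.cos (2 * π * t) : ℝ)) : ℂ) := by fun_prop
  have hgc : ContinuousOn g (Icc 0 1) :=
    (continuousOn_const.add (hcosc.continuousOn.mul (hKc.comp hγc.continuousOn fun t _ => hγcl t)))
  -- non-vanishing on the circle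
  have hF0 : ∀ t : ℝ, F (γ t) ≠ 0 := by
    intro t h0
    have := hcirc (γ t) (hγnorm t)
    rw [hGF t, h0, mul_zero] at this
    exact this rfl
  have hγa0 : ∀ t : ℝ, 2 * (γ t - a) ≠ 0 := by
    intro t h0
    have h1 : γ t - a = 0 := by
      rcases mul_eq_zero.1 h0 with h | h
      · norm_num at h
      · exact h
    have := hγnorm t
    rw [h1, norm_zero] at this
    exact hb.ne' this.symm |>.elim
  have hg0 : ∀ t : ℝ, g t ≠ 0 := by
    intro t h0
    have := hF0 t
    rw [hFg t, h0, mul_zero] at this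
    exact this rfl
  -- the loops
  have Lh : IsNonvanishingLoop (fun t => h (γ t)) :=
    ⟨hh.continuousOn.comp hγc.continuousOn fun t _ => hγball t, fun t _ => hh0 _ (hγcl t), by simp only [h01γ]⟩
  have LF : IsNonvanishingLoop (fun t => F (γ t)) :=
    ⟨hFc.comp hγc.continuousOn fun t _ => hγcl t, fun t _ => hF0 t, by simp only [h01γ]⟩
  have L2 : IsNonvanishingLoop (fun t => 2 * (γ t - a)) :=
    ⟨(continuous_const.mul (hγc.sub continuous_const)).continuousOn, fun t _ => hγa0 t, by simp only [h01γ]⟩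
  have g01 : g 0 = g 1 := by
    simp only [hg]; rw [h01γ, mul_zero, mul_one, Real.cos_zero, Real.cos_two_pi]
  have Lg : IsNonvanishingLoop g := ⟨hgc, fun t _ => hg0 t, g01⟩
  -- winding numbers: `G′∘γ`, `h∘γ`, `2(γ − a)`
  have W0 := Rouche.wind_circleLoop_eq_finsum_divisor (deriv G) hb hbρ hG'd fun u hu => hcirc u hu
  have Wh : wind (fun t => h (γ t)) = 0 := by
    have hsph : ∀ u : ℂ, ‖u - a‖ = b → h u ≠ 0 := fun u hu => hh0 u (by rw [mem_closedBall, dist_eq_norm, hu])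
    have := Rouche.wind_circleLoop_eq_finsum_divisor h hb hbρ hh hsph
    rw [hγ, this]
    apply finsum_eq_zero_of_forall_eq_zero
    intro u
    by_contra hne
    obtain ⟨hu, h0⟩ := (Rouche.divisor_ne_zero_iff h hb hbρ hh hsph u).1 hne
    exact hh0 u hu h0
  have W2 : wind (fun t => 2 * (γ t - a)) = 1 := by
    have e : wind (fun t => (fun _ : ℝ => (2 : ℂ)) t * (fun t => γ t - (a : ℂ)) t) =
        wind (fun _ : ℝ => (2 : ℂ)) + wind (fun t => γ t - (a : ℂ)) :=
      wind_mul (IsNonvanishingLoop.const two_ne_zero) ⟨(hγc.sub continuous_const).continuousOn,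
        fun t _ h0 => hγa0 t (by rw [h0, mul_zero]), by simp only [h01γ]⟩
    simp only at e
    rw [e, wind_const, zero_add, hγ]
    exact wind_circleLoop_sub_of_norm_lt (by rw [sub_self, norm_zero]; exact hb)
  -- the sign pattern of `g`
  have him_g : ∀ t : ℝ, (g t).im = b * Real.cos (2 * π * t) * (K (γ t)).im := by
    intro t; simp only [hg, add_im, one_im, im_ofReal_mul, zero_add]
  have hre_g : ∀ t : ℝ, (g t).re = 1 + b * Real.cos (2 * π * t) * (K (γ t)).re := by
    intro t; simp only [hg, add_re, one_re, re_ofReal_mul]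
  have hKsign : ∀ t : ℝ, Real.sin (2 * π * t) * (K (γ t)).im ≤ 0 := by
    intro t
    have h1 := hsign (γ t) (hγnorm t)
    rw [hγim t] at h1
    by_contra hp
    push Not at hp
    have := mul_pos hb hp
    linarith [this, h1, show b * Real.sin (2 * π * t) * (K (γ t)).im = b * (Real.sin (2 * π * t) * (K (γ t)).im) by ring]
  have hKup : ∀ t : ℝ, 0 < t → t < 1 / 2 → (K (γ t)).im ≤ 0 := by
    intro t h0 h1
    have hs : 0 < Real.sin (2 * π * t) :=
      Real.sin_pos_of_pos_of_lt_pi (by positivity) (by nlinarith [Real.pi_pos])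
    have := hKsign t
    by_contra hp; push Not at hp
    have := mul_pos hs hp; linarith
  have hKlow : ∀ t : ℝ, 1 / 2 < t → t < 1 → 0 ≤ (K (γ t)).im := by
    intro t h0 h1
    have hs : Real.sin (2 * π * t) < 0 := by
      rw [← Real.sin_sub_two_pi]
      exact Real.sin_neg_of_neg_of_neg_pi_lt (by nlinarith [Real.pi_pos]) (by nlinarith [Real.pi_pos])
    have := hKsign t
    by_contra hp; push Not at hp
    have := mul_pos_of_neg_of_neg hs hp; linarith
  have hKreal' : ∀ t : ℝ, (∃ x : ℝ, γ t = (x : ℂ)) → (K (γ t)).im = 0 := by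
    rintro t ⟨x, hx⟩
    have hn := hγnorm t
    rw [hx] at hn ⊢
    exact hKreal x hn
  have hK0 : (K (γ 0)).im = 0 := hKreal' 0 ⟨a + b, hγ0⟩
  have hKhalf : (K (γ (1 / 2))).im = 0 := hKreal' (1 / 2) ⟨a - b, hγhalf⟩
  have hK1 : (K (γ 1)).im = 0 := by rw [← h01γ]; exact hK0
  have hq1 : ∀ t ∈ Icc (0:ℝ) (1/4), (g t).im ≤ 0 := by
    intro t ht
    rw [him_g]
    rcases eq_or_lt_of_le ht.1 with h | h
    · rw [← h, hK0, mul_zero]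
    · have hc : 0 ≤ Real.cos (2 * π * t) :=
        Real.cos_nonneg_of_neg_pi_div_two_le_of_le (by nlinarith [Real.pi_pos, ht.1]) (by nlinarith [Real.pi_pos, ht.2])
      exact mul_nonpos_iff.2 (Or.inl ⟨mul_nonneg hb.le hc, hKup t h (by linarith [ht.2])⟩)
  have hq2 : ∀ t ∈ Icc (1/4:ℝ) (1/2), 0 ≤ (g t).im := by
    intro t ht
    rw [him_g]
    rcases eq_or_lt_of_le ht.2 with h | h
    · rw [h, hKhalf, mul_zero]
    · have hc : Real.cos (2 * π * t) ≤ 0 :=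
        Real.cos_nonpos_of_pi_div_two_le_of_le (by nlinarith [Real.pi_pos, ht.1]) (by nlinarith [Real.pi_pos, ht.2])
      exact mul_nonneg_iff.2 (Or.inr ⟨mul_nonpos_iff.2 (Or.inl ⟨hb.le, hc⟩), hKup t (by linarith [ht.1]) h⟩)
  have hq3 : ∀ t ∈ Icc (1/2:ℝ) (3/4), (g t).im ≤ 0 := by
    intro t ht
    rw [him_g]
    rcases eq_or_lt_of_le ht.1 with h | h
    · rw [← h, hKhalf, mul_zero]
    · have hc : Real.cos (2 * π * t) ≤ 0 :=
        Real.cos_nonpos_of_pi_div_two_le_of_le (by nlinarith [Real.pi_pos, ht.1]) (by nlinarith [Real.pi_pos, ht.2])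
      exact mul_nonpos_iff.2 (Or.inr ⟨mul_nonpos_iff.2 (Or.inl ⟨hb.le, hc⟩), hKlow t h (by linarith [ht.2])⟩)
  have hq4 : ∀ t ∈ Icc (3/4:ℝ) 1, 0 ≤ (g t).im := by
    intro t ht
    rw [him_g]
    rcases eq_or_lt_of_le ht.2 with h | h
    · rw [h, hK1, mul_zero]
    · have hc : 0 ≤ Real.cos (2 * π * t) := by
        rw [← Real.cos_sub_two_pi]
        exact Real.cos_nonneg_of_neg_pi_div_two_le_of_le (by nlinarith [Real.pi_pos, ht.1]) (by nlinarith [Real.pi_pos, ht.2])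
      exact mul_nonneg (mul_nonneg hb.le hc) (hKlow t (by linarith [ht.1]) h)
  have hcos1 : Real.cos (2 * π * (1 / 4)) = 0 := by rw [show 2 * π * (1 / 4 : ℝ) = π / 2 by ring]; exact Real.cos_pi_div_two
  have hcos3 : Real.cos (2 * π * (3 / 4)) = 0 := by
    rw [show 2 * π * (3 / 4 : ℝ) = π / 2 + π by ring, Real.cos_add_pi, Real.cos_pi_div_two, neg_zero]
  have hr0 : (g 0).im = 0 := by rw [him_g, hK0, mul_zero]
  have hr2 : (g (1 / 2)).im = 0 := by rw [him_g, hKhalf, mul_zero]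
  have hr1 : (g (1 / 4)).im = 0 := by rw [him_g, hcos1, mul_zero, zero_mul]
  have hr3 : (g (3 / 4)).im = 0 := by rw [him_g, hcos3, mul_zero, zero_mul]
  have hp1 : 0 < (g (1 / 4)).re := by rw [hre_g, hcos1, mul_zero, zero_mul, add_zero]; exact one_pos
  have hp3 : 0 < (g (3 / 4)).re := by rw [hre_g, hcos3, mul_zero, zero_mul, add_zero]; exact one_pos
  have Wg := wind_eq_of_quadrants hgc g01 (fun t _ => hg0 t) hq1 hq2 hq3 hq4 hr0 hr2 hr1 hp1 hr3 hp3
  have g0re : (g 0).re = 1 + b * (deriv h ((a : ℂ) + b) / h ((a : ℂ) + b)).re := by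
    rw [hre_g, mul_zero, Real.cos_zero, mul_one, hγ0]; push_cast; rfl
  have ghre : (g (1 / 2)).re = 1 - b * (deriv h ((a : ℂ) - b) / h ((a : ℂ) - b)).re := by
    rw [hre_g, show 2 * π * (1 / 2 : ℝ) = π by ring, Real.cos_pi, hγhalf]; push_cast; simp only [hK]; ring
  -- assembly
  calc ∑ᶠ u, MeromorphicOn.divisor (deriv G) (closedBall (a : ℂ) b) u
      = wind (fun t => deriv G (γ t)) := W0.symm
    _ = wind (fun t => h (γ t) * F (γ t)) := congrArg wind (funext hGF)
    _ = wind (fun t => h (γ t)) + wind (fun t => F (γ t)) := wind_mul Lh LF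
    _ = wind (fun t => F (γ t)) := by rw [Wh, zero_add]
    _ = wind (fun t => 2 * (γ t - a) * g t) := congrArg wind (funext hFg)
    _ = wind (fun t => 2 * (γ t - a)) + wind g := wind_mul L2 Lg
    _ = 1 + wind g := by rw [W2]
    _ = _ := by rw [Wg, g0re, ghre]; ring

end RhW08.ChildCount

/-! # RATE CHILD COUNT (B) — downward zeros on the diameter and EXISTENCE of the upper child from the count
(lens-2 g4, crux item stmt-RiemannHypothesis-33346; module 2/3 of the (CA557) cut; namespace `RhW08.ChildCount`; imports (A) only; 0 `sorry`.)

§3 real-axis bookkeeping for a `C¹` function all of whose zeros on `[α, β]` are DOWNWARD (`φ′ < 0`): `sign_near_downward_zero`,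
`pos_left_of_downward`, `neg_right_of_downward`, `card_le_one_of_downward` (at most one zero; positive to its left, negative to its right).
§4 `eq_feet_of_real_on_circle` and ★★★ `exists_upper_child`: in the setting of `childCount` (A), if moreover `G` is real on `ℝ`, every REAL
critical point `x` of `G` on the closed diameter `|x − a| ≤ b` has `G(x)·G″(x) < 0` («no NL event») and `G′ ≠ 0` at the two feet `a ± b`, then
`G′` has a NON-REAL zero `w` with `Im w > 0`, `G(w) ≠ 0`, `‖w − a‖ ≤ b` (the count is `#real + 2`; boundary critical points by a direct case split).
Nothing here bears on the truth of RH; RH is not proved; 33346/33347 OPEN; checked ≠ proved. -/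

noncomputable section

open Complex Metric Set
open scoped Real ComplexConjugate
open Literature.Topology.PlaneTopology
open Literature.Analysis.Complex
open RhW08.IsolatedTilt (pairQ)

namespace RhW08.ChildCount

/-! ## §3 real axis: a function all of whose zeros are DOWNWARD (`φ′ < 0`) has at most one zero, is positive to the left of it and negative
to the right — elementary IVT bookkeeping (the «no NL event on the diameter» input of §4) -/

/-- (K) local sign at a downward zero. -/
theorem sign_near_downward_zero {φ : ℝ → ℝ} {x d : ℝ} (h0 : φ x = 0) (hd : HasDerivAt φ d x) (hneg : d < 0) :
    ∃ δ > 0, (∀ y, x < y → y < x + δ → φ y < 0) ∧ (∀ y, x - δ < y → y < x → 0 < φ y) := by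
  have ht := hasDerivAt_iff_tendsto_slope.1 hd
  have hev : ∀ᶠ y in nhdsWithin x {x}ᶜ, slope φ x y < 0 := (tendsto_order.1 ht).2 0 hneg
  rw [eventually_nhdsWithin_iff, Metric.eventually_nhds_iff] at hev
  obtain ⟨δ, hδ, hδ'⟩ := hev
  refine ⟨δ, hδ, fun y h1 h2 => ?_, fun y h1 h2 => ?_⟩
  · have hy : y ∈ ({x}ᶜ : Set ℝ) := fun h => by simp only [mem_singleton_iff] at h; linarith
    have := hδ' (by rw [Real.dist_eq, abs_of_pos (by linarith)]; linarith) hy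
    rw [slope_def_field, h0, sub_zero] at this
    have := (div_lt_iff₀ (by linarith : 0 < y - x)).1 this
    linarith
  · have hy : y ∈ ({x}ᶜ : Set ℝ) := fun h => by simp only [mem_singleton_iff] at h; linarith
    have := hδ' (by rw [Real.dist_eq, abs_of_neg (by linarith)]; linarith) hy
    rw [slope_def_field, h0, sub_zero] at this
    have := (div_lt_iff_of_neg (by linarith : y - x < 0)).1 this
    linarith

/-- (K) if every zero of `φ` in `[α, β]` lies in the finite set `T ⊂ (α, β)` of downward zeros and `T ≠ ∅`, then `0 < φ α`. -/
theorem pos_left_of_downward {φ : ℝ → ℝ} {α β : ℝ} (hφ : ContinuousOn φ (Icc α β)) (T : Finset ℝ)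
    (hT : ∀ x ∈ Icc α β, φ x = 0 → x ∈ T) (hTsub : ∀ x ∈ T, x ∈ Ioo α β ∧ φ x = 0)
    (hdown : ∀ x ∈ T, ∃ d < 0, HasDerivAt φ d x) (hne : T.Nonempty) : 0 < φ α := by
  set x₁ := T.min' hne with hx₁
  have hx₁T : x₁ ∈ T := T.min'_mem hne
  obtain ⟨⟨hαx, hxβ⟩, hz⟩ := hTsub x₁ hx₁T
  obtain ⟨d, hd, hder⟩ := hdown x₁ hx₁T
  obtain ⟨δ, hδ, -, hleft⟩ := sign_near_downward_zero hz hder hd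
  set y := max α (x₁ - δ / 2) with hy
  have hy1 : y < x₁ := max_lt hαx (by linarith)
  have hy2 : x₁ - δ < y := lt_of_lt_of_le (by linarith) (le_max_right _ _)
  have hφy : 0 < φ y := hleft y hy2 hy1
  have hαy : α ≤ y := le_max_left _ _
  by_contra hneg
  push Not at hneg
  have hα0 : φ α ≠ 0 := fun h => by
    have := (hTsub α (hT α ⟨le_rfl, by linarith⟩ h)).1.1; linarith
  have hcont : ContinuousOn φ (Icc α y) := hφ.mono (Icc_subset_Icc le_rfl (by linarith))
  obtain ⟨z, hz1, hz2⟩ := intermediate_value_Icc hαy hcont ⟨hneg, hφy.le⟩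
  have hzT := hT z ⟨hz1.1, by linarith [hz1.2]⟩ hz2
  have := T.min'_le z hzT
  linarith [hz1.2]

/-- (K) … and `φ β < 0`. -/
theorem neg_right_of_downward {φ : ℝ → ℝ} {α β : ℝ} (hφ : ContinuousOn φ (Icc α β)) (T : Finset ℝ)
    (hT : ∀ x ∈ Icc α β, φ x = 0 → x ∈ T) (hTsub : ∀ x ∈ T, x ∈ Ioo α β ∧ φ x = 0)
    (hdown : ∀ x ∈ T, ∃ d < 0, HasDerivAt φ d x) (hne : T.Nonempty) : φ β < 0 := by
  set x₂ := T.max' hne with hx₂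
  have hx₂T : x₂ ∈ T := T.max'_mem hne
  obtain ⟨⟨hαx, hxβ⟩, hz⟩ := hTsub x₂ hx₂T
  obtain ⟨d, hd, hder⟩ := hdown x₂ hx₂T
  obtain ⟨δ, hδ, hright, -⟩ := sign_near_downward_zero hz hder hd
  set y := min β (x₂ + δ / 2) with hy
  have hy1 : x₂ < y := lt_min hxβ (by linarith)
  have hy2 : y < x₂ + δ := lt_of_le_of_lt (min_le_right _ _) (by linarith)
  have hφy : φ y < 0 := hright y hy1 hy2
  have hyβ : y ≤ β := min_le_left _ _
  by_contra hpos
  push Not at hpos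
  have hβ0 : φ β ≠ 0 := fun h => by
    have := (hTsub β (hT β ⟨by linarith, le_rfl⟩ h)).1.2; linarith
  have hcont : ContinuousOn φ (Icc y β) := hφ.mono (Icc_subset_Icc (by linarith) le_rfl)
  obtain ⟨z, hz1, hz2⟩ := intermediate_value_Icc hyβ hcont ⟨hφy.le, hpos⟩
  have hzT := hT z ⟨by linarith [hz1.1], hz1.2⟩ hz2
  have := T.le_max' z hzT
  linarith [hz1.1]

/-- (K) … and there is AT MOST ONE zero. -/
theorem card_le_one_of_downward {φ : ℝ → ℝ} {α β : ℝ} (hφ : ContinuousOn φ (Icc α β)) (T : Finset ℝ)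
    (hT : ∀ x ∈ Icc α β, φ x = 0 → x ∈ T) (hTsub : ∀ x ∈ T, x ∈ Ioo α β ∧ φ x = 0)
    (hdown : ∀ x ∈ T, ∃ d < 0, HasDerivAt φ d x) : T.card ≤ 1 := by
  by_contra hlt
  push Not at hlt
  have hne : T.Nonempty := Finset.card_pos.1 (by omega)
  set x₁ := T.min' hne with hx₁
  have hx₁T : x₁ ∈ T := T.min'_mem hne
  have hne' : (T.erase x₁).Nonempty := Finset.card_pos.1 (by rw [Finset.card_erase_of_mem hx₁T]; omega)
  set x₂ := (T.erase x₁).min' hne' with hx₂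
  have hx₂T' : x₂ ∈ T.erase x₁ := (T.erase x₁).min'_mem hne'
  have hx₂T : x₂ ∈ T := Finset.mem_of_mem_erase hx₂T'
  have h12 : x₁ < x₂ := lt_of_le_of_ne (T.min'_le x₂ hx₂T) (Finset.ne_of_mem_erase hx₂T').symm
  have hadj : ∀ z ∈ T, x₁ < z → x₂ ≤ z := fun z hz hlz =>
    (T.erase x₁).min'_le z (Finset.mem_erase.2 ⟨hlz.ne', hz⟩)
  obtain ⟨⟨hα1, h1β⟩, hz1⟩ := hTsub x₁ hx₁T
  obtain ⟨⟨hα2, h2β⟩, hz2⟩ := hTsub x₂ hx₂T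
  obtain ⟨d₁, hd₁, hder₁⟩ := hdown x₁ hx₁T
  obtain ⟨d₂, hd₂, hder₂⟩ := hdown x₂ hx₂T
  obtain ⟨δ₁, hδ₁, hright, -⟩ := sign_near_downward_zero hz1 hder₁ hd₁
  obtain ⟨δ₂, hδ₂, -, hleft⟩ := sign_near_downward_zero hz2 hder₂ hd₂
  set y₁ := min (x₁ + δ₁ / 2) ((x₁ + x₂) / 2) with hy₁
  set y₂ := max y₁ (x₂ - δ₂ / 2) with hy₂
  have hy₁1 : x₁ < y₁ := lt_min (by linarith) (by linarith)
  have hy₁2 : y₁ < x₁ + δ₁ := lt_of_le_of_lt (min_le_left _ _) (by linarith)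
  have hy₁3 : y₁ < x₂ := lt_of_le_of_lt (min_le_right _ _) (by linarith)
  have hy₂1 : y₁ ≤ y₂ := le_max_left _ _
  have hy₂2 : y₂ < x₂ := max_lt hy₁3 (by linarith)
  have hy₂3 : x₂ - δ₂ < y₂ := lt_of_lt_of_le (by linarith) (le_max_right _ _)
  have hφ1 : φ y₁ < 0 := hright y₁ hy₁1 hy₁2
  have hφ2 : 0 < φ y₂ := hleft y₂ hy₂3 hy₂2
  have hcont : ContinuousOn φ (Icc y₁ y₂) := hφ.mono (Icc_subset_Icc (by linarith) (by linarith))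
  obtain ⟨z, hzI, hz0⟩ := intermediate_value_Icc hy₂1 hcont ⟨hφ1.le, hφ2.le⟩
  have hzT := hT z ⟨by linarith [hzI.1], by linarith [hzI.2]⟩ hz0
  have := hadj z hzT (by linarith [hzI.1])
  linarith [hzI.2]

/-! ## §4 EXISTENCE (and oddness) of the nested moving child from the count: «no NL event on the closed diameter» -/

/-- (K) the real points of the Jensen circle are the two feet `a ± b`. -/
theorem eq_feet_of_real_on_circle {a b : ℝ} {z : ℂ} (hz : ‖z - a‖ = b) (hzim : z.im = 0) :
    z = (a : ℂ) + b ∨ z = (a : ℂ) - b := by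
  have e : ‖z - (a : ℂ)‖ ^ 2 = (z.re - a) ^ 2 + z.im ^ 2 := by
    rw [← Complex.normSq_eq_norm_sq, Complex.normSq_apply]; simp; ring
  rw [hz, hzim] at e
  have hsq : (z.re - a) ^ 2 = b ^ 2 := by nlinarith [e]
  rcases sq_eq_sq_iff_eq_or_eq_neg.1 hsq with h | h
  · left; exact Complex.ext (by simp; linarith) (by simp [hzim])
  · right; exact Complex.ext (by simp; linarith) (by simp [hzim])

set_option maxHeartbeats 1600000 in
/-- ★★★ (K) **THE NESTED MOVING CHILD EXISTS** (generic feet).  `G = q·h` real entire (`q = pairQ a b`, `0 < b`), `h` real entire and zero-free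
on the closed Jensen disc `‖z − a‖ ≤ b` with the Jensen sign on its boundary circle; NO NL EVENT of `G` on the closed diameter
(`G′(x) = 0 ⇒ G(x)·G″(x) < 0` for `|x − a| ≤ b`); `G′ ≠ 0` at the two feet `a ± b`.  Then `G′` has an UPPER NON-REAL zero `w` with `G(w) ≠ 0`
in the closed Jensen disc: `‖w − a‖ ≤ b`. -/
theorem exists_upper_child {G h : ℂ → ℂ} {a b ρ : ℝ} (hb : 0 < b) (hbρ : b < ρ)
    (hGd : Differentiable ℂ G) (hh : Differentiable ℂ h) (hfac : ∀ z, G z = pairQ a b z * h z)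
    (hGreal : ∀ x : ℝ, (G x).im = 0) (hhreal : ∀ x : ℝ, (h x).im = 0)
    (hh0 : ∀ z ∈ closedBall (a : ℂ) b, h z ≠ 0)
    (hsign : ∀ z : ℂ, ‖z - a‖ = b → z.im * (deriv h z / h z).im ≤ 0)
    (hnoNL : ∀ x : ℝ, |x - a| ≤ b → (deriv G x).re = 0 → (G x).re * (deriv (deriv G) x).re < 0)
    (hfeet : deriv G ((a : ℂ) + b) ≠ 0 ∧ deriv G ((a : ℂ) - b) ≠ 0) :
    ∃ w : ℂ, deriv G w = 0 ∧ G w ≠ 0 ∧ 0 < w.im ∧ ‖w - a‖ ≤ b := by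
  classical
  -- realness and symmetry
  have hG'd : Differentiable ℂ (deriv G) := by
    have := differentiable_iteratedDeriv_of_entire hGd 1; rwa [iteratedDeriv_one] at this
  have hG'real : ∀ x : ℝ, (deriv G x).im = 0 := fun x => by
    have := im_iteratedDeriv_ofReal hGd hGreal 1 x; rwa [iteratedDeriv_one] at this
  have hh'real : ∀ x : ℝ, (deriv h x).im = 0 := fun x => by
    have := im_iteratedDeriv_ofReal hh hhreal 1 x; rwa [iteratedDeriv_one] at this
  have hderiv : ∀ z, deriv G z = 2 * (z - a) * h z + pairQ a b z * deriv h z := by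
    intro z
    have e : G = fun w => pairQ a b w * h w := funext hfac
    rw [e]
    exact ((RhW07.Law421.SuccessorCertificate.hasDerivAt_quadP a b z).mul (hh z).hasDerivAt).deriv
  have hq0 : ∀ u : ℂ, pairQ a b u = 0 → ‖u - a‖ = b := by
    intro u hu
    rw [RhW08.IsolatedTilt.pairQ_eq_mul] at hu
    rcases mul_eq_zero.1 hu with h | h
    · rw [sub_eq_zero] at h; rw [h]; simp [abs_of_pos hb]
    · rw [sub_eq_zero] at h; rw [h]; simp [abs_of_pos hb]
  have hGne : ∀ u : ℂ, ‖u - a‖ ≤ b → deriv G u = 0 → G u ≠ 0 := by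
    intro u hu hu0 hG0
    have hhu : h u ≠ 0 := hh0 u (by rw [mem_closedBall, dist_eq_norm]; exact hu)
    rw [hfac u] at hG0
    rcases mul_eq_zero.1 hG0 with hq | hh'
    · have e := hderiv u
      rw [hu0, hq, zero_mul, add_zero] at e
      have hua : u - a ≠ 0 := by
        intro h0; have := hq0 u hq; rw [h0, norm_zero] at this; exact hb.ne' this.symm
      exact hhu ((mul_eq_zero.1 e.symm).resolve_left (mul_ne_zero two_ne_zero hua))
    · exact hhu hh'
  have hconj : ∀ z, deriv G (conj z) = conj (deriv G z) := apply_conj_eq_conj hG'd hG'real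
  have hnorm_conj : ∀ z : ℂ, ‖conj z - a‖ = ‖z - a‖ := by
    intro z; rw [← Complex.norm_conj (z - a), map_sub, Complex.conj_ofReal]
  -- a non-real critical point ON the circle settles it
  by_cases hex : ∃ w : ℂ, ‖w - a‖ = b ∧ w.im ≠ 0 ∧ deriv G w = 0
  · obtain ⟨w, hw, hwim, hw0⟩ := hex
    rcases lt_or_gt_of_ne hwim with hneg | hpos
    · have hc0 : deriv G (conj w) = 0 := by rw [hconj, hw0, map_zero]
      exact ⟨conj w, hc0, hGne _ (by rw [hnorm_conj]; exact hw.le) hc0, by rw [conj_im]; linarith,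
        by rw [hnorm_conj]; exact hw.le⟩
    · exact ⟨w, hw0, hGne w hw.le hw0, hpos, hw.le⟩
  push Not at hex
  have hcirc : ∀ z : ℂ, ‖z - a‖ = b → deriv G z ≠ 0 := by
    intro z hz
    by_cases hzim : z.im = 0
    · rcases eq_feet_of_real_on_circle hz hzim with h | h
      · rw [h]; exact hfeet.1
      · rw [h]; exact hfeet.2
    · exact hex z hz hzim
  have hKreal : ∀ x : ℝ, ‖(x : ℂ) - a‖ = b → (deriv h x / h x).im = 0 := by
    intro x _
    have e1 : deriv h x = (((deriv h x).re : ℝ) : ℂ) := Complex.ext (by rw [ofReal_re]) (by rw [ofReal_im]; exact hh'real x)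
    have e2 : h x = (((h x).re : ℝ) : ℂ) := Complex.ext (by rw [ofReal_re]) (by rw [ofReal_im]; exact hhreal x)
    rw [e1, e2, ← ofReal_div, ofReal_im]
  have hcount := childCount hb hbρ hGd.differentiableOn hh.differentiableOn (fun z _ => hfac z) hh0 hsign hKreal hcirc
  -- suppose there is no nested upper child
  by_contra hne
  push Not at hne
  -- then every critical point in the closed disc is real …
  have hzr : ∀ u ∈ closedBall (a : ℂ) b, deriv G u = 0 → u.im = 0 := by
    intro u hu hu0
    rw [mem_closedBall, dist_eq_norm] at hu
    by_contra him
    rcases lt_or_gt_of_ne him with hneg | hpos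
    · have hc0 : deriv G (conj u) = 0 := by rw [hconj, hu0, map_zero]
      have h1 := hne (conj u) hc0 (hGne _ (by rw [hnorm_conj]; exact hu) hc0) (by rw [conj_im]; linarith)
      rw [hnorm_conj] at h1; linarith
    · have h1 := hne u hu0 (hGne u hu hu0) hpos; linarith
  -- … and simple
  have hzs : ∀ u ∈ closedBall (a : ℂ) b, deriv G u = 0 → deriv (deriv G) u ≠ 0 := by
    intro u hu hu0
    have him := hzr u hu hu0
    rw [mem_closedBall, dist_eq_norm] at hu
    have hux : u = ((u.re : ℝ) : ℂ) := Complex.ext (by rw [ofReal_re]) (by rw [ofReal_im]; exact him)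
    have habs : |u.re - a| ≤ b := by
      have := Complex.abs_re_le_norm (u - a); simp only [sub_re, ofReal_re] at this; exact this.trans hu
    have h0 : (deriv G (u.re : ℝ)).re = 0 := by rw [← hux, hu0]; simp
    have := hnoNL u.re habs h0
    intro hd
    rw [hux] at hd
    rw [hd] at this
    simp at this
  have hm := Rouche.finsum_divisor_eq_ncard_zeros (deriv G) hb hbρ hG'd.differentiableOn hcirc hzs
  -- the real zero set of `G′` on the open diameter
  set Z : Set ℝ := {x | x ∈ Ioo (a - b) (a + b) ∧ (deriv G x).re = 0} with hZ
  have hZim : {u : ℂ | ‖u - (a : ℂ)‖ < b ∧ deriv G u = 0} = (fun x : ℝ => (x : ℂ)) '' Z := by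
    ext u
    constructor
    · rintro ⟨hu, hu0⟩
      have him := hzr u (by rw [mem_closedBall, dist_eq_norm]; exact hu.le) hu0
      have hux : u = ((u.re : ℝ) : ℂ) := Complex.ext (by rw [ofReal_re]) (by rw [ofReal_im]; exact him)
      refine ⟨u.re, ⟨?_, ?_⟩, hux.symm⟩
      · have h1 : |u.re - a| ≤ ‖u - (a : ℂ)‖ := by
          have := Complex.abs_re_le_norm (u - a); simpa only [sub_re, ofReal_re] using this
        have h2 := abs_lt.1 (lt_of_le_of_lt h1 hu)
        exact ⟨by linarith [h2.1], by linarith [h2.2]⟩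
      · rw [← hux, hu0]; simp
    · rintro ⟨x, ⟨hx, hx0⟩, rfl⟩
      refine ⟨?_, Complex.ext (by rw [zero_re]; exact hx0) (by rw [zero_im]; exact hG'real x)⟩
      rw [← ofReal_sub, Complex.norm_real, Real.norm_eq_abs, abs_lt]
      exact ⟨by linarith [hx.1], by linarith [hx.2]⟩
  have hfin : Z.Finite := by
    have hf := Rouche.finite_zeros (deriv G) hb hbρ hG'd.differentiableOn hcirc
    refine Set.Finite.of_finite_image ?_ Complex.ofReal_injective.injOn
    rw [← hZim]
    exact hf.subset fun u ⟨hu, hu0⟩ => ⟨by rw [mem_closedBall, dist_eq_norm]; exact hu.le, hu0⟩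
  have hncard : ({u : ℂ | ‖u - (a : ℂ)‖ < b ∧ deriv G u = 0}.ncard : ℤ) = (hfin.toFinset.card : ℤ) := by
    rw [hZim, Set.ncard_image_of_injective _ Complex.ofReal_injective, Set.ncard_eq_toFinset_card _ hfin]
  -- the real function `φ = Re G′ / Re G` on the closed diameter: continuous, zeros = real critical points, all DOWNWARD
  set φ : ℝ → ℝ := fun x => (deriv G x).re / (G x).re with hφ
  have hball : ∀ x : ℝ, |x - a| ≤ b → (x : ℂ) ∈ closedBall (a : ℂ) b := fun x hx => by
    rw [mem_closedBall, dist_eq_norm, ← ofReal_sub, Complex.norm_real, Real.norm_eq_abs]; exact hx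
  have hGx : ∀ x : ℝ, |x - a| ≤ b → (G x).re ≠ 0 := by
    intro x hx h0
    have hGx0 : G x = 0 := Complex.ext (by rw [zero_re]; exact h0) (by rw [zero_im]; exact hGreal x)
    rw [hfac] at hGx0
    rcases mul_eq_zero.1 hGx0 with hq | hh'
    · have eq : pairQ a b (x : ℂ) = ((((x - a) ^ 2 + b ^ 2 : ℝ)) : ℂ) := by simp only [pairQ]; push_cast; ring
      have hQ : 0 < (x - a) ^ 2 + b ^ 2 := by positivity
      rw [eq] at hq
      exact hQ.ne' (by exact_mod_cast hq)
    · exact hh0 _ (hball x hx) hh'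
  have hφc : ContinuousOn φ (Icc (a - b) (a + b)) := by
    have c1 : Continuous fun x : ℝ => (deriv G x).re :=
      Complex.continuous_re.comp (hG'd.continuous.comp Complex.continuous_ofReal)
    have c2 : Continuous fun x : ℝ => (G x).re :=
      Complex.continuous_re.comp (hGd.continuous.comp Complex.continuous_ofReal)
    exact c1.continuousOn.div c2.continuousOn fun x hx => hGx x (abs_le.2 ⟨by linarith [hx.1], by linarith [hx.2]⟩)
  have hφzero : ∀ x : ℝ, |x - a| ≤ b → (φ x = 0 ↔ (deriv G x).re = 0) := by
    intro x hx
    simp only [hφ, div_eq_zero_iff]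
    exact ⟨fun h => h.resolve_right (hGx x hx), Or.inl⟩
  have hdown : ∀ x : ℝ, |x - a| ≤ b → φ x = 0 → ∃ d < 0, HasDerivAt φ d x := by
    intro x hx h0
    have h0' := (hφzero x hx).1 h0
    have h1 : HasDerivAt (fun y : ℝ => (deriv G y).re) (deriv (deriv G) x).re x :=
      (hG'd x).hasDerivAt.real_of_complex
    have h2 : HasDerivAt (fun y : ℝ => (G y).re) (deriv G x).re x := (hGd x).hasDerivAt.real_of_complex
    refine ⟨_, ?_, h1.div h2 (hGx x hx)⟩
    rw [h0', zero_mul, sub_zero]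
    have := hnoNL x hx h0'
    have hsq : 0 < (G x).re ^ 2 := lt_of_le_of_ne (sq_nonneg _) (Ne.symm (pow_ne_zero 2 (hGx x hx)))
    have hc : (deriv (deriv G) ↑x).re * (G ↑x).re < 0 := by rw [mul_comm]; exact this
    exact div_neg_of_neg_of_pos hc hsq
  -- the finite set `T` of real critical points and the three real-axis lemmas of §3
  set T := hfin.toFinset with hT
  have hTmem : ∀ x, x ∈ T ↔ x ∈ Ioo (a - b) (a + b) ∧ (deriv G x).re = 0 := fun x => by
    rw [hT, Set.Finite.mem_toFinset]; rfl
  have hreal_zero : ∀ x : ℝ, (deriv G x).re = 0 → deriv G x = 0 := fun x h0 =>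
    Complex.ext (by rw [zero_re]; exact h0) (by rw [zero_im]; exact hG'real x)
  have hT1 : ∀ x ∈ Icc (a - b) (a + b), φ x = 0 → x ∈ T := by
    intro x hx h0
    have hxa : |x - a| ≤ b := abs_le.2 ⟨by linarith [hx.1], by linarith [hx.2]⟩
    have h0' := (hφzero x hxa).1 h0
    rw [hTmem]
    refine ⟨⟨lt_of_le_of_ne hx.1 ?_, lt_of_le_of_ne hx.2 ?_⟩, h0'⟩
    · intro h
      apply hfeet.2
      have e : ((x : ℝ) : ℂ) = (a : ℂ) - b := by rw [← h]; push_cast; ring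
      rw [← e]; exact hreal_zero x h0'
    · intro h
      apply hfeet.1
      have e : ((x : ℝ) : ℂ) = (a : ℂ) + b := by rw [h]; push_cast; ring
      rw [← e]; exact hreal_zero x h0'
  have hT2 : ∀ x ∈ T, x ∈ Ioo (a - b) (a + b) ∧ φ x = 0 := by
    intro x hx
    rw [hTmem] at hx
    exact ⟨hx.1, (hφzero x (abs_le.2 ⟨by linarith [hx.1.1], by linarith [hx.1.2]⟩)).2 hx.2⟩
  have hT3 : ∀ x ∈ T, ∃ d < 0, HasDerivAt φ d x := fun x hx =>
    hdown x (abs_le.2 ⟨by linarith [(hT2 x hx).1.1], by linarith [(hT2 x hx).1.2]⟩) (hT2 x hx).2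
  -- the value of `φ` on the diameter and at the two feet
  have hφval : ∀ x : ℝ, |x - a| ≤ b → φ x = 2 * (x - a) / ((x - a) ^ 2 + b ^ 2) + (deriv h x / h x).re := by
    intro x hx
    have hu0 : (h x).re ≠ 0 := by
      intro h0
      exact hh0 _ (hball x hx) (Complex.ext (by rw [zero_re]; exact h0) (by rw [zero_im]; exact hhreal x))
    have eh : h x = (((h x).re : ℝ) : ℂ) := Complex.ext (by rw [ofReal_re]) (by rw [ofReal_im]; exact hhreal x)
    have eh' : deriv h x = (((deriv h x).re : ℝ) : ℂ) :=
      Complex.ext (by rw [ofReal_re]) (by rw [ofReal_im]; exact hh'real x)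
    have eq : pairQ a b (x : ℂ) = ((((x - a) ^ 2 + b ^ 2 : ℝ)) : ℂ) := by simp only [pairQ]; push_cast; ring
    have hQ : 0 < (x - a) ^ 2 + b ^ 2 := by positivity
    have eG : G x = ((((x - a) ^ 2 + b ^ 2) * (h x).re : ℝ) : ℂ) := by
      rw [hfac, eq]; nth_rw 1 [eh]; push_cast; ring
    have eG' : deriv G x = (((2 * (x - a) * (h x).re + ((x - a) ^ 2 + b ^ 2) * (deriv h x).re : ℝ)) : ℂ) := by
      rw [hderiv, eq]; nth_rw 1 [eh]; nth_rw 1 [eh']; push_cast; ring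
    have eK : (deriv h x / h x).re = (deriv h x).re / (h x).re := by
      nth_rw 1 [eh', eh]; rw [← ofReal_div, ofReal_re]
    simp only [hφ]
    rw [eG', eG, ofReal_re, ofReal_re, eK]
    field_simp
  have hfoot1 : 1 + b * (deriv h ((a : ℂ) + b) / h ((a : ℂ) + b)).re = b * φ (a + b) := by
    have := hφval (a + b) (by rw [add_sub_cancel_left, abs_of_pos hb])
    push_cast at this
    rw [this]
    field_simp
    ring
  have hfoot2 : 1 - b * (deriv h ((a : ℂ) - b) / h ((a : ℂ) - b)).re = -(b * φ (a - b)) := by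
    have := hφval (a - b) (by rw [sub_sub_cancel_left, abs_neg, abs_of_pos hb])
    push_cast at this
    rw [this]
    field_simp
    ring
  have c1 : (b * φ (a + b) < 0) ↔ (φ (a + b) < 0) :=
    ⟨fun h => by by_contra h'; push Not at h'; nlinarith [mul_nonneg hb.le h'], fun h => mul_neg_of_pos_of_neg hb h⟩
  have c2 : (-(b * φ (a - b)) < 0) ↔ (0 < φ (a - b)) := by
    rw [neg_lt_zero]; exact mul_pos_iff_of_pos_left hb
  -- the count in terms of `T.card`
  have hcard : (T.card : ℤ) = 1 + (if φ (a + b) < 0 then 1 else 0) + (if 0 < φ (a - b) then 1 else 0) := by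
    have e := hm.symm.trans hcount
    rw [hncard, hfoot1, hfoot2] at e
    simp only [c1, c2] at e
    exact e
  rcases T.eq_empty_or_nonempty with hTe | hTne
  · simp only [hTe, Finset.card_empty, Nat.cast_zero] at hcard
    split_ifs at hcard <;> omega
  · have h1 := pos_left_of_downward hφc T hT1 hT2 hT3 hTne
    have h2 := neg_right_of_downward hφc T hT1 hT2 hT3 hTne
    have h3 := card_le_one_of_downward hφc T hT1 hT2 hT3
    rw [if_pos h2, if_pos h1] at hcard
    omega


end RhW08.ChildCount

/-! # RATE CHILD COUNT (C) — the FRAME corollaries: R1a′ `FarChildExistsLawSep` at a SIMPLE lowest zero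
(lens-2 g4, crux item stmt-RiemannHypothesis-33346; module 3/3 of the (CA557) cut; namespace `RhW08.ChildCount`; imports (B), the tree's
`…R3NestedSign` (`RhW08.NestedSign.im_mul_im_logDeriv_nonpos`, `exists_cofactor`: the Jensen sign of the cofactor field) and lens-1's tree
`…R3Lens1PinningIsoB` (`RhW08.Lens1PinningIso.pinning_of_jensenIsolated'` — dirty feet allowed —, `JensenIsolated`); 0 `sorry`; v2 of the
module = crit-1 CUT-11b (l.7819): the `CleanFeet` binder of v1 is discharged by the primed pinning theorem and dropped.)

§5 ★★★ `exists_child_of_separated` (analysis form: `f` real entire of order `< 2`, `v` a simple `R/2`-isolated zero of `f⁽ʲ⁾` separated from the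
taller zoo (C′) with `Im v < R/4`, no `NLEventOf f j` on the closed diameter, `f⁽ʲ⁺¹⁾ ≠ 0` at the feet ⇒ an upper zero `w` of `f⁽ʲ⁺¹⁾` with
`f⁽ʲ⁾ w ≠ 0` in the closed Jensen disc), ★★★ `farChild_of_sep_simple` (the `EngineHyps5 2` / `Charged` / `IsLowest StTrkDQ` wrapper: `Charged ⇒`
no NL event of level `j` in the window ⊇ the diameter), `FarChildExistsLawSepSimple` (= R1a′ `RhW08.BurgersRateG3.FarChildExistsLawSep` VERBATIM +
binders simple · `Im v < R/4` · generic feet) + `_holds`.  §6 (v2, the `R/4` binder REMOVED): ★★★ `farChild_of_pinning` — R1a′ + binders simple ·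
LOW-CLEAR (`Im v + Im z < |Re v − Re z|` for the other upper zeros `z` with `Im z ≤ Im v`), as a corollary of lens-1's landed
`pinning_of_jensenIsolated'` (no clean-feet hypothesis); ★ `lowclear_of_R4` (v1's regime ⊆ v2's); `FarChildExistsLawSepSimpleJ` + `_holds`.
LEAVES of R1a′ after this module (separate items, none hides the crux): L1 multiplicity of `v`; L2ᴶ low-clearness beyond the strip (bites only when
`Im v + Im z ≥ R/2`).  Nothing here bears on the truth of RH; RH is not proved; 33346/33347 OPEN; checked ≠ proved. -/

noncomputable section

open Complex Metric Set
open scoped Real ComplexConjugate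
open Literature.Topology.PlaneTopology
open Literature.Analysis.Complex
open RhW08.IsolatedTilt (pairQ)

namespace RhW08.ChildCount

/-! ## §5 the FRAME: `f` real entire of order `< 2`, `v` a simple isolated separated lowest zero of `f⁽ʲ⁾` with `Im v < R/4`,
no NL event of level `j` on the closed diameter (⇐ `Charged`, i.e. `¬ TiltReady` at level `j`), generic feet ⇒ R1a′'s conclusion -/

open Summit.RiemannHypothesis.RiemannHypothesis.Theorems.Splittings.JensenWindow (RealEntireLt2) in
open RhIdea6.G17.W07C7 (NLEventOf) in
set_option maxHeartbeats 1600000 in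
/-- ★★★ (K) **EXISTENCE + LOCALISATION of the nested moving child** (analysis form).  `f` real entire of order `< 2`; `v` a SIMPLE upper zero of
`G = f⁽ʲ⁾`, ISOLATED (`|Re z − Re v| < R/2 ⇒ z ∈ {v, v̄}`), SEPARATED from every strictly taller zero (lens-1's C′), `Im v < R/4`; NO NL EVENT of
level `j` on the closed diameter `|x − Re v| ≤ Im v`; `f⁽ʲ⁺¹⁾ ≠ 0` at the two feet `Re v ± Im v`.  Then `f⁽ʲ⁺¹⁾` has an upper non-real zero `w`
with `f⁽ʲ⁾(w) ≠ 0` in the closed Jensen disc `‖w − Re v‖ ≤ Im v`. -/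
theorem exists_child_of_separated {f : ℂ → ℂ} (hf : RealEntireLt2 f) (j : ℕ) {v : ℂ} {R : ℝ}
    (hv : iteratedDeriv j f v = 0) (hv0 : 0 < v.im) (hsimp : iteratedDeriv (j + 1) f v ≠ 0)
    (hiso : ∀ z : ℂ, iteratedDeriv j f z = 0 → |z.re - v.re| < R / 2 → z = v ∨ z = conj v)
    (hsep : ∀ z : ℂ, iteratedDeriv j f z = 0 → v.im < z.im → v.im + z.im < |v.re - z.re|)
    (hR4 : v.im < R / 4) (hnoNL : ∀ x : ℝ, |x - v.re| ≤ v.im → ¬ NLEventOf f j x)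
    (hfeet : iteratedDeriv (j + 1) f ((v.re : ℂ) + v.im) ≠ 0 ∧ iteratedDeriv (j + 1) f ((v.re : ℂ) - v.im) ≠ 0) :
    ∃ w : ℂ, iteratedDeriv (j + 1) f w = 0 ∧ iteratedDeriv j f w ≠ 0 ∧ 0 < w.im ∧ ‖w - (v.re : ℂ)‖ ≤ v.im := by
  classical
  have hG : RealEntireLt2 (iteratedDeriv j f) := RhW08.WindowLoss.realEntireLt2_iteratedDeriv hf j
  set G := iteratedDeriv j f with hGdef
  have hG1 : iteratedDeriv (j + 1) f = deriv G := by rw [iteratedDeriv_succ]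
  have hG2 : iteratedDeriv (j + 2) f = deriv (deriv G) := by
    rw [show j + 2 = j + 1 + 1 from rfl, iteratedDeriv_succ, iteratedDeriv_succ]
  obtain ⟨h, hhd, ⟨ρ, C, hρ0, hρ, hgr⟩, hreal, hfac⟩ := RhW08.NestedSign.exists_cofactor hG hv hv0.ne'
  have hderiv : ∀ z, deriv G z = 2 * (z - v.re) * h z + pairQ v.re v.im z * deriv h z := by
    intro z
    have e : G = fun w => pairQ v.re v.im w * h w := funext hfac
    rw [e]
    exact ((RhW07.Law421.SuccessorCertificate.hasDerivAt_quadP v.re v.im z).mul (hhd z).hasDerivAt).deriv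
  -- simplicity of `v` ⇒ the cofactor does not vanish at `v`, `v̄`; isolation ⇒ nowhere on the closed Jensen disc
  have hhv : h v ≠ 0 := by
    intro h0
    apply hsimp
    have hq : pairQ v.re v.im v = 0 := by
      rw [RhW08.IsolatedTilt.pairQ_eq_mul, Complex.re_add_im, sub_self, zero_mul]
    rw [hG1, hderiv v, h0, mul_zero, zero_add, hq, zero_mul]
  have hhvbar : h (conj v) ≠ 0 := by rw [apply_conj_eq_conj hhd hreal, map_ne_zero]; exact hhv
  have hh0 : ∀ z ∈ closedBall ((v.re : ℝ) : ℂ) v.im, h z ≠ 0 := by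
    intro z hz h0
    rw [mem_closedBall, dist_eq_norm] at hz
    have hGz : G z = 0 := by rw [hfac z, h0, mul_zero]
    have hre : |z.re - v.re| < R / 2 := by
      have h1 : |z.re - v.re| ≤ ‖z - (v.re : ℂ)‖ := by
        have := Complex.abs_re_le_norm (z - v.re); simpa only [sub_re, ofReal_re] using this
      linarith
    rcases hiso z hGz hre with hzv | hzv
    · exact hhv (hzv ▸ h0)
    · exact hhvbar (hzv ▸ h0)
  -- the Jensen sign on the whole circle (isolation, separation C′, `Im v < R/4`)
  have hsign : ∀ z : ℂ, ‖z - (v.re : ℂ)‖ = v.im → z.im * (deriv h z / h z).im ≤ 0 := by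
    intro z hz
    have hzball : z ∈ closedBall ((v.re : ℝ) : ℂ) v.im := by rw [mem_closedBall, dist_eq_norm]; exact hz.le
    refine RhW08.NestedSign.im_mul_im_logDeriv_nonpos hhd hρ0 hρ hgr hreal (hh0 z hzball) fun a' ha' => ?_
    have hGa : G a' = 0 := by rw [hfac a', ha', mul_zero]
    have hav : a' ≠ v := fun e => hhv (e ▸ ha')
    have hav' : a' ≠ conj v := fun e => hhvbar (e ▸ ha')
    have hfar : R / 2 ≤ |a'.re - v.re| := by
      by_contra hlt
      push Not at hlt
      rcases hiso a' hGa hlt with e | e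
      · exact hav e
      · exact hav' e
    have hlow : |a'.re - v.re| - v.im ≤ ‖z - (a'.re : ℂ)‖ := by
      have h1 : |z.re - a'.re| ≤ ‖z - (a'.re : ℂ)‖ := by
        have := Complex.abs_re_le_norm (z - a'.re); simpa only [sub_re, ofReal_re] using this
      have h2 : |z.re - v.re| ≤ v.im := by
        have := Complex.abs_re_le_norm (z - v.re); simp only [sub_re, ofReal_re] at this; linarith
      have h3 := abs_sub_le a'.re z.re v.re
      rw [abs_sub_comm a'.re z.re] at h3
      linarith
    by_cases htall : v.im < |a'.im|
    · rcases le_or_gt 0 a'.im with hnn | hneg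
      · rw [abs_of_nonneg hnn] at htall ⊢
        have := hsep a' hGa htall
        rw [abs_sub_comm] at this
        linarith
      · rw [abs_of_neg hneg] at htall ⊢
        have hGa' : G (conj a') = 0 := by rw [apply_conj_eq_conj hG.diff hG.real, hGa, map_zero]
        have := hsep (conj a') hGa' (by rw [conj_im]; exact htall)
        rw [conj_im, conj_re, abs_sub_comm] at this
        linarith
    · push Not at htall
      linarith
  -- no NL event on the closed diameter ⇒ the `GG″ < 0` shape of §4 (isolation: `G ≠ 0` on the diameter)
  have hnoNL' : ∀ x : ℝ, |x - v.re| ≤ v.im → (deriv G x).re = 0 → (G x).re * (deriv (deriv G) x).re < 0 := by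
    intro x hx h1
    have hGx : (G x).re ≠ 0 := by
      intro h0
      have hGx0 : G x = 0 := Complex.ext (by rw [zero_re]; exact h0) (by rw [zero_im]; exact hG.real x)
      have hx' : |(x : ℂ).re - v.re| < R / 2 := by rw [ofReal_re]; linarith
      rcases hiso x hGx0 hx' with e | e
      · have := congrArg Complex.im e; rw [ofReal_im] at this; linarith
      · have := congrArg Complex.im e; rw [ofReal_im, conj_im] at this; linarith
    have hn := hnoNL x hx
    unfold NLEventOf at hn
    rw [← hGdef, hG1, hG2] at hn
    by_contra hge
    push Not at hge
    exact hn ⟨h1, hGx, hge⟩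
  have hfeet' : deriv G ((v.re : ℂ) + v.im) ≠ 0 ∧ deriv G ((v.re : ℂ) - v.im) ≠ 0 := by rw [← hG1]; exact hfeet
  obtain ⟨w, hw1, hw2, hw3, hw4⟩ :=
    exists_upper_child (ρ := 2 * v.im) hv0 (by linarith) hG.diff hhd hfac hG.real hreal hh0 hsign hnoNL' hfeet'
  exact ⟨w, by rw [hG1]; exact hw1, hw2, hw3, hw4⟩

open Summit.RiemannHypothesis.RiemannHypothesis.Theorems.Splittings.JensenWindow (RealEntireLt2) in
open RhIdea6.G17.W07C7 RhIdea6.G17.W07C7.Rev6 RhIdea6.G18.W07C8.Law421BirthS RhIdea6.G19.W07C11.Seam RhIdea6.G20.W07C12.Frac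
  RhIdea6.G20.W07C12.StColP RhW07.C12.FieldSplit RhW08.Round1 RhW08.StSwap RhW08.Round2 RhW08.QuadW RhW08.SealSwapQ in
open RhW08.SealSwap (PBot) in
/-- ★★★ (K) **R1a′ `FarChildExistsLawSep` AT A SIMPLE LOWEST ZERO with `Im v < R/4` and generic feet — PROVED.**  In an `EngineHyps5 2` frame,
at a CHARGED level `j` (so `¬ TiltReady`: no NL event of level `j` in the window `|x − x₀| < (j+3)R/2`, which contains the closed diameter of
the lowest band state `v`), for `v` lowest, simple, isolated (`R/2`), separated (C′) with `Im v < R/4` and `f⁽ʲ⁺¹⁾(Re v ± Im v) ≠ 0`: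
there IS a moving upper child `w` of `f⁽ʲ⁺¹⁾` with `f⁽ʲ⁾ w ≠ 0` in the closed Jensen disc `‖w − Re v‖ ≤ |Im v|` — R1a′'s conclusion verbatim.
No weak-field / strong-field hypothesis: the winding count (§2) replaces the field dichotomy. -/
theorem farChild_of_sep_simple {η : ℝ} {f : ℂ → ℂ} {x₀ s hmax R Hs : ℝ} {B : ℕ} (hE : EngineHyps5 2 η f x₀ s hmax R Hs B)
    {j : ℕ} {v : ℂ} (hC : Charged (PTrkSQ PBot) StTrkDQ ReadyR2 η f x₀ s hmax R Hs B j)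
    (hlow : IsLowest StTrkDQ η f x₀ s hmax R Hs B j v) (hsimp : iteratedDeriv (j + 1) f v ≠ 0)
    (hiso : ∀ z : ℂ, iteratedDeriv j f z = 0 → |z.re - v.re| < R / 2 → z = v ∨ z = conj v)
    (hsep : ∀ z : ℂ, iteratedDeriv j f z = 0 → v.im < z.im → v.im + z.im < |v.re - z.re|)
    (hR4 : v.im < R / 4)
    (hfeet : iteratedDeriv (j + 1) f ((v.re : ℂ) + v.im) ≠ 0 ∧ iteratedDeriv (j + 1) f ((v.re : ℂ) - v.im) ≠ 0) :
    ∃ w : ℂ, iteratedDeriv (j + 1) f w = 0 ∧ iteratedDeriv j f w ≠ 0 ∧ 0 < w.im ∧ ‖w - (v.re : ℂ)‖ ≤ |v.im| := by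
  have hf : RealEntireLt2 f := RhW08.Column.realEntireLt2_of_hyps hE
  have hv : iteratedDeriv j f v = 0 := hlow.1.2.1
  have hv0 : 0 < v.im := hlow.1.2.2.1
  have hbud : (max (|v.re - x₀| - R / 2) 0) ^ 2 + (j : ℝ) * v.im ^ 2 ≤ (j : ℝ) * Hs ^ 2 := hlow.1.2.2.2.1
  obtain ⟨-, -, -, hs, hsh, hhR, -, hHs0, -, hHsR, -⟩ := hE
  have hR : 0 < R := by linarith
  -- the closed diameter of `v` lies inside the window of `TiltReady` at level `j`
  have hwin : ∀ x : ℝ, |x - v.re| ≤ v.im → |x - x₀| < ((j : ℝ) + 3) * R / 2 := by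
    intro x hx
    have hm0 : 0 ≤ max (|v.re - x₀| - R / 2) 0 := le_max_right _ _
    have hm1 : |v.re - x₀| - R / 2 ≤ max (|v.re - x₀| - R / 2) 0 := le_max_left _ _
    have hj : (0 : ℝ) ≤ j := Nat.cast_nonneg j
    have hj2 : (j : ℝ) ≤ (j : ℝ) ^ 2 := by
      rcases Nat.eq_zero_or_pos j with h0 | hpos
      · simp [h0]
      · have : (1 : ℝ) ≤ j := by exact_mod_cast hpos
        nlinarith
    have hm2 : (max (|v.re - x₀| - R / 2) 0) ^ 2 ≤ (j : ℝ) * (R / 2) ^ 2 := by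
      have h1 : (max (|v.re - x₀| - R / 2) 0) ^ 2 ≤ (j : ℝ) * Hs ^ 2 := by nlinarith [sq_nonneg v.im]
      have h2 : Hs ^ 2 ≤ (R / 2) ^ 2 := by nlinarith
      nlinarith
    have hm3 : max (|v.re - x₀| - R / 2) 0 ≤ (j : ℝ) * (R / 2) := by
      have h4 : (max (|v.re - x₀| - R / 2) 0) ^ 2 ≤ ((j : ℝ) * (R / 2)) ^ 2 := by nlinarith [sq_nonneg R]
      exact (pow_le_pow_iff_left₀ hm0 (by positivity) two_ne_zero).1 h4
    have h5 := abs_sub_le x v.re x₀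
    nlinarith
  -- `Charged` ⇒ `¬ ReadyR2` at level `j` ⇒ no NL event of level `j` in the window
  have hnoNL : ∀ x : ℝ, |x - v.re| ≤ v.im → ¬ NLEventOf f j x := by
    obtain ⟨v', -, hnr, -⟩ := hC
    intro x hx hNL
    apply hnr
    unfold ReadyR2 CumReady WinOrTilt TiltReady
    exact ⟨j, le_rfl, Or.inr ⟨x, hwin x hx, hNL⟩⟩
  obtain ⟨w, h1, h2, h3, h4⟩ := exists_child_of_separated hf j hv hv0 hsimp hiso hsep hR4 hnoNL hfeet
  exact ⟨w, h1, h2, h3, by rwa [abs_of_pos hv0]⟩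

open RhIdea6.G17.W07C7 RhIdea6.G17.W07C7.Rev6 RhIdea6.G18.W07C8.Law421BirthS RhIdea6.G19.W07C11.Seam RhIdea6.G20.W07C12.Frac
  RhIdea6.G20.W07C12.StColP RhW07.C12.FieldSplit RhW08.Round1 RhW08.StSwap RhW08.Round2 RhW08.QuadW RhW08.SealSwapQ in
open RhW08.SealSwap (PBot) in
/-- (LAW R1a′∘ — R1a′ `FarChildExistsLawSep` (Glue2A-v4a l.53) VERBATIM with three extra binders appended: `v` SIMPLE, `Im v < R/4`, generic
feet.)  Typed here to record exactly what is proved; `FarChildExistsLawSep → FarChildExistsLawSepSimple` is trivial, and the converse is the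
three leaves (multiplicity, the sliver `R/4 ≤ Im v ≤ Hs`, feet degeneracy). -/
def FarChildExistsLawSepSimple : Prop :=
  ∀ (η : ℝ) (f : ℂ → ℂ) (x₀ s hmax R Hs : ℝ) (B : ℕ), EngineHyps5 2 η f x₀ s hmax R Hs B → ∀ (j : ℕ) (v : ℂ),
    Charged (PTrkSQ PBot) StTrkDQ ReadyR2 η f x₀ s hmax R Hs B j → IsLowest StTrkDQ η f x₀ s hmax R Hs B j v →
    (∀ z : ℂ, iteratedDeriv j f z = 0 → |z.re - v.re| < R / 2 → z = v ∨ z = conj v) →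
    (∀ z : ℂ, iteratedDeriv j f z = 0 → v.im < z.im → v.im + z.im < |v.re - z.re|) →
    iteratedDeriv (j + 1) f v ≠ 0 → v.im < R / 4 →
    (iteratedDeriv (j + 1) f ((v.re : ℂ) + v.im) ≠ 0 ∧ iteratedDeriv (j + 1) f ((v.re : ℂ) - v.im) ≠ 0) →
    ∃ w : ℂ, iteratedDeriv (j + 1) f w = 0 ∧ iteratedDeriv j f w ≠ 0 ∧ 0 < w.im ∧ ‖w - (v.re : ℂ)‖ ≤ |v.im|

/-- ★★★ (K) **R1a′∘ HOLDS.** -/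
theorem farChildExistsLawSepSimple_holds : FarChildExistsLawSepSimple :=
  fun _ _ _ _ _ _ _ _ hE _ _ hC hlow hiso hsep hsimp hR4 hfeet => farChild_of_sep_simple hE hC hlow hsimp hiso hsep hR4 hfeet


/-! ## §6 (v2, crit-1 HANDS-39 l.7787 repair of leaf L2) `R/4` REMOVED: the binder becomes LOW-CLEARNESS of the lower-or-equal zoo, and the
existence half is then a COROLLARY of lens-1's LANDED Walsh–Jensen pinning `RhW08.Lens1PinningIso.pinning_of_jensenIsolated'` (dirty feet
allowed; cited, not re-derived) + isolation + simplicity; the count of §2–§4 stays as the sharper statement (uniqueness: `N = #real + 2`). -/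

open RhIdea6.G17.W07C7 RhIdea6.G17.W07C7.Rev6 RhIdea6.G18.W07C8.Law421BirthS RhIdea6.G19.W07C11.Seam RhIdea6.G20.W07C12.Frac
  RhIdea6.G20.W07C12.StColP RhW07.C12.FieldSplit RhW08.Round1 RhW08.StSwap RhW08.Round2 RhW08.QuadW RhW08.SealSwapQ in
open RhW08.SealSwap (PBot) in
open RhW08.Lens1PinningIso (JensenIsolated pinning_of_jensenIsolated') in
/-- ★★★ (K) **R1a′ AT A SIMPLE LOWEST ZERO, NO `R/4`, NO CLEAN FEET** (v2).  In an `EngineHyps5 2` frame, at a CHARGED level `j`, let `v` be lowest, SIMPLE,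
isolated (`R/2`), separated from every taller zero (C′), LOW-CLEAR (every OTHER upper zero `z` of `f⁽ʲ⁾` with `Im z ≤ Im v` has its closed Jensen disc
DISJOINT from `v`'s: `Im v + Im z < |Re v − Re z|`; by isolation such `z` have `|Re z − Re v| ≥ R/2`, so this only bites in the sliver
`Im v + Im z ≥ R/2`).  Then R1a′'s conclusion holds.  PROOF = lens-1's landed `pinning_of_jensenIsolated'` (dirty feet allowed; C′ + low-clearness = `JensenIsolated f j v`; `Charged` kills the NL-event branch on the diameter; `NestedStep` = the
closed Jensen disc; conjugate to the upper half-plane; `f⁽ʲ⁾ w ≠ 0` by isolation + simplicity, the strict `|Re w − Re v| < Im v ≤ R/2` coming from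
`Im w ≠ 0`). -/
theorem farChild_of_pinning {η : ℝ} {f : ℂ → ℂ} {x₀ s hmax R Hs : ℝ} {B : ℕ} (hE : EngineHyps5 2 η f x₀ s hmax R Hs B)
    {j : ℕ} {v : ℂ} (hC : Charged (PTrkSQ PBot) StTrkDQ ReadyR2 η f x₀ s hmax R Hs B j)
    (hlow : IsLowest StTrkDQ η f x₀ s hmax R Hs B j v) (hsimp : iteratedDeriv (j + 1) f v ≠ 0)
    (hiso : ∀ z : ℂ, iteratedDeriv j f z = 0 → |z.re - v.re| < R / 2 → z = v ∨ z = conj v)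
    (hsep : ∀ z : ℂ, iteratedDeriv j f z = 0 → v.im < z.im → v.im + z.im < |v.re - z.re|)
    (hlowclear : ∀ z : ℂ, iteratedDeriv j f z = 0 → 0 < z.im → z.im ≤ v.im → z ≠ v → v.im + z.im < |v.re - z.re|) :
    ∃ w : ℂ, iteratedDeriv (j + 1) f w = 0 ∧ iteratedDeriv j f w ≠ 0 ∧ 0 < w.im ∧ ‖w - (v.re : ℂ)‖ ≤ |v.im| := by
  have hf : Summit.RiemannHypothesis.RiemannHypothesis.Theorems.Splittings.JensenWindow.RealEntireLt2 f :=
    RhW08.Column.realEntireLt2_of_hyps hE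
  have hv : iteratedDeriv j f v = 0 := hlow.1.2.1
  have hv0 : 0 < v.im := hlow.1.2.2.1
  have hvHs : v.im ≤ Hs := hlow.1.2.2.2.2
  have hbud : (max (|v.re - x₀| - R / 2) 0) ^ 2 + (j : ℝ) * v.im ^ 2 ≤ (j : ℝ) * Hs ^ 2 := hlow.1.2.2.2.1
  have hE' := hE
  obtain ⟨-, -, -, hs, hsh, hhR, -, hHs0, -, hHsR, -⟩ := hE'
  have hR : 0 < R := by linarith
  -- the closed diameter of `v` lies inside the window of `TiltReady` at level `j`
  have hwin : ∀ x : ℝ, |x - v.re| ≤ v.im → |x - x₀| < ((j : ℝ) + 3) * R / 2 := by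
    intro x hx
    have hm0 : 0 ≤ max (|v.re - x₀| - R / 2) 0 := le_max_right _ _
    have hm1 : |v.re - x₀| - R / 2 ≤ max (|v.re - x₀| - R / 2) 0 := le_max_left _ _
    have hj : (0 : ℝ) ≤ j := Nat.cast_nonneg j
    have hm2 : (max (|v.re - x₀| - R / 2) 0) ^ 2 ≤ (j : ℝ) * (R / 2) ^ 2 := by
      have h1 : (max (|v.re - x₀| - R / 2) 0) ^ 2 ≤ (j : ℝ) * Hs ^ 2 := by nlinarith [sq_nonneg v.im]
      have h2 : Hs ^ 2 ≤ (R / 2) ^ 2 := by nlinarith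
      nlinarith
    have hm3 : max (|v.re - x₀| - R / 2) 0 ≤ (j : ℝ) * (R / 2) := by
      have hj2 : (j : ℝ) ≤ (j : ℝ) ^ 2 := by
        rcases Nat.eq_zero_or_pos j with h0 | hpos
        · simp [h0]
        · have : (1 : ℝ) ≤ j := by exact_mod_cast hpos
          nlinarith
      have h4 : (max (|v.re - x₀| - R / 2) 0) ^ 2 ≤ ((j : ℝ) * (R / 2)) ^ 2 := by nlinarith [sq_nonneg R]
      exact (pow_le_pow_iff_left₀ hm0 (by positivity) two_ne_zero).1 h4
    have h5 := abs_sub_le x v.re x₀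
    nlinarith
  -- `Charged` ⇒ `¬ ReadyR2` at level `j` ⇒ no NL event of level `j` in the window
  have hnoNL : ∀ x : ℝ, |x - v.re| ≤ v.im → ¬ NLEventOf f j x := by
    obtain ⟨v', -, hnr, -⟩ := hC
    intro x hx hNL
    apply hnr
    unfold ReadyR2 CumReady WinOrTilt TiltReady
    exact ⟨j, le_rfl, Or.inr ⟨x, hwin x hx, hNL⟩⟩
  -- C′ + low-clearness = lens-1's `JensenIsolated`
  have hJ : JensenIsolated f j v := by
    intro c hc hcpos hcv
    rcases le_or_gt c.im v.im with hle | hgt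
    · exact Or.inl (hlowclear c hc hcpos hle hcv)
    · exact Or.inl (hsep c hc hgt)
  rcases pinning_of_jensenIsolated' hE hv hv0 hJ with ⟨w, hw, hwim, hnest⟩ | ⟨x, hx, hNL⟩
  · -- a non-real critical point in the closed Jensen disc; conjugate it into the upper half-plane
    have hd : Differentiable ℂ (iteratedDeriv (j + 1) f) := differentiable_iteratedDeriv_of_entire hf.diff (j + 1)
    have hreal : ∀ x : ℝ, (iteratedDeriv (j + 1) f x).im = 0 := fun x => im_iteratedDeriv_ofReal hf.diff hf.real (j + 1) x
    -- the upper representative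
    obtain ⟨u, hu, hupos, hunest⟩ : ∃ u : ℂ, iteratedDeriv (j + 1) f u = 0 ∧ 0 < u.im ∧ NestedStep v u := by
      rcases lt_or_gt_of_ne hwim with hneg | hpos
      · refine ⟨conj w, ?_, ?_, ?_⟩
        · rw [apply_conj_eq_conj hd hreal, hw, map_zero]
        · rw [conj_im]; linarith
        · unfold NestedStep at hnest ⊢; rw [conj_re, conj_im]; nlinarith
      · exact ⟨w, hw, hpos, hnest⟩
    refine ⟨u, hu, ?_, hupos, ?_⟩
    · -- `f⁽ʲ⁾ u ≠ 0`: else isolation forces `u = v` (simplicity) or `u = v̄` (sign)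
      intro hGu
      have hre : |u.re - v.re| < R / 2 := by
        unfold NestedStep at hunest
        have h1 : (u.re - v.re) ^ 2 < v.im ^ 2 := by nlinarith
        have h2 : |u.re - v.re| < |v.im| := sq_lt_sq.1 h1
        rw [abs_of_pos hv0] at h2
        linarith
      rcases hiso u hGu hre with e | e
      · exact hsimp (e ▸ hu)
      · have := congrArg Complex.im e; rw [conj_im] at this; linarith
    · -- the closed Jensen disc
      unfold NestedStep at hunest
      have h1 : ‖u - (v.re : ℂ)‖ ^ 2 = (u.re - v.re) ^ 2 + u.im ^ 2 := by
        rw [Complex.sq_norm, Complex.normSq_apply, sub_re, sub_im, ofReal_re, ofReal_im, sub_zero]; ring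
      have h2 : ‖u - (v.re : ℂ)‖ ^ 2 ≤ |v.im| ^ 2 := by rw [h1, sq_abs]; exact hunest
      exact (pow_le_pow_iff_left₀ (norm_nonneg _) (abs_nonneg _) two_ne_zero).1 h2
  · exact absurd hNL (hnoNL x hx)

/-- ★ (K) **v2 ⊇ v1's regime.** Under `R/2`-isolation, `Im v < R/4` makes LOW-CLEARNESS automatic (the lower-or-equal zoo sits `≥ R/2 > 2·Im v`
away laterally) — so §6 strictly contains §5's regime (and drops §5's generic-feet hypothesis). -/
theorem lowclear_of_R4 {f : ℂ → ℂ} {j : ℕ} {v : ℂ} {R : ℝ}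
    (hiso : ∀ z : ℂ, iteratedDeriv j f z = 0 → |z.re - v.re| < R / 2 → z = v ∨ z = conj v) (hR4 : v.im < R / 4) :
    ∀ z : ℂ, iteratedDeriv j f z = 0 → 0 < z.im → z.im ≤ v.im → z ≠ v → v.im + z.im < |v.re - z.re| := by
  intro z hz hzpos hle hzv
  have hfar : R / 2 ≤ |z.re - v.re| := by
    by_contra hlt
    push Not at hlt
    rcases hiso z hz hlt with e | e
    · exact hzv e
    · have := congrArg Complex.im e; rw [conj_im] at this; linarith
  rw [abs_sub_comm] at hfar
  linarith

open RhIdea6.G17.W07C7 RhIdea6.G17.W07C7.Rev6 RhIdea6.G18.W07C8.Law421BirthS RhIdea6.G19.W07C11.Seam RhIdea6.G20.W07C12.Frac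
  RhIdea6.G20.W07C12.StColP RhW07.C12.FieldSplit RhW08.Round1 RhW08.StSwap RhW08.Round2 RhW08.QuadW RhW08.SealSwapQ in
open RhW08.SealSwap (PBot) in
/-- (LAW R1a′ᴶ — R1a′ `FarChildExistsLawSep` VERBATIM with two appended binders: `v` SIMPLE, LOW-CLEAR; no `R/4`, no clean feet.)  The honest
residual of R1a′ after v2 is exactly: multiplicity (L1) + the low-clearness of the lowest band state w.r.t. the lower-or-equal zoo BEYOND the strip
(L2ᴶ: `Im v + Im z < |Re v − Re z|` for zeros `z ∉ {v, v̄}` with `0 < Im z ≤ Im v`, automatically true when `Im v + Im z < R/2`). -/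
def FarChildExistsLawSepSimpleJ : Prop :=
  ∀ (η : ℝ) (f : ℂ → ℂ) (x₀ s hmax R Hs : ℝ) (B : ℕ), EngineHyps5 2 η f x₀ s hmax R Hs B → ∀ (j : ℕ) (v : ℂ),
    Charged (PTrkSQ PBot) StTrkDQ ReadyR2 η f x₀ s hmax R Hs B j → IsLowest StTrkDQ η f x₀ s hmax R Hs B j v →
    (∀ z : ℂ, iteratedDeriv j f z = 0 → |z.re - v.re| < R / 2 → z = v ∨ z = conj v) →
    (∀ z : ℂ, iteratedDeriv j f z = 0 → v.im < z.im → v.im + z.im < |v.re - z.re|) →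
    iteratedDeriv (j + 1) f v ≠ 0 →
    (∀ z : ℂ, iteratedDeriv j f z = 0 → 0 < z.im → z.im ≤ v.im → z ≠ v → v.im + z.im < |v.re - z.re|) →
    ∃ w : ℂ, iteratedDeriv (j + 1) f w = 0 ∧ iteratedDeriv j f w ≠ 0 ∧ 0 < w.im ∧ ‖w - (v.re : ℂ)‖ ≤ |v.im|

/-- ★★★ (K) **R1a′ᴶ HOLDS** (v2: no `R/4`, no clean feet). -/
theorem farChildExistsLawSepSimpleJ_holds : FarChildExistsLawSepSimpleJ :=
  fun _ _ _ _ _ _ _ _ hE _ _ hC hlow hiso hsep hsimp hlc => farChild_of_pinning hE hC hlow hsimp hiso hsep hlc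


end RhW08.ChildCount
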